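import Summits.QuantumFields.YangMills.Theorems.EquipartitionCriticalityEquipartitionPinsProbeTangentLaws
import Summits.QuantumFields.YangMills.Theorems.EquipartitionCriticalityEquipartitionPinsProbeRigidity
import Summits.QuantumFields.YangMills.Theorems.EquipartitionCriticalityEquipartitionPinsProbeFactorization
import Summits.QuantumFields.YangMills.Theorems.EquipartitionCriticalityEquipartitionPinsProbeExactShiftInvariance
import Summits.QuantumFields.YangMills.Theorems.EquipartitionCriticalityEquipartitionPinsProbeSteinFlow
import Summits.QuantumFields.YangMills.Theorems.EquipartitionCriticalityEquipartitionPinsProbeKernelFixesExact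
import Summits.QuantumFields.YangMills.Theorems.EquipartitionCriticalityEquipartitionPinsProbeCubeShiftInvariance
import Summits.QuantumFields.YangMills.Theorems.EquipartitionCriticalityEquipartitionPinsProbeKernelClosed
import Summits.QuantumFields.YangMills.Theorems.EquipartitionCriticalityEquipartitionPinsProbeDensity
import Summits.QuantumFields.YangMills.Theorems.EquipartitionCriticalityEquipartitionPinsProbeCosMoment
import Summits.QuantumFields.YangMills.Theorems.EquipartitionCriticalityEquipartitionPinsProbeLineVariance
import Summits.QuantumFields.YangMills.Theorems.EquipartitionCriticalityEquipartitionPinsProbeGaussFromCharFun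
import Summits.QuantumFields.YangMills.Theorems.EquipartitionCriticalityEquipartitionPinsProbeReduction
import Literature.MathematicalPhysics.QuantumFieldTheory.CurvatureGaussianField
import HarnessLib

/-!
# The local free-gluon law (crux `stmt-QuantumFields-8760`, line `Sketch`, STUB `stub_localLaw`)

Route `EquipartitionCriticality` of `YangMills`, crux `EquipartitionPinsProbe`, line `Sketch`. The one
physics statement of the line — the LOCAL FREE-GLUON LAW in its two-plaquette gauge-invariant shadow
(`stub_localLaw`, registered by lead gen 0): under uniform equipartition there is `D ≥ 1` such that the
covariance of the probe `e^{−2(β(N − Re tr r(U_p)))₊}` at the origin plaquette in the `(1,2)` plane with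
its translate by `n e₀` converges, uniformly over torus-limit states as `β → ∞`, to the corresponding
covariance under the lattice Maxwell field `curvatureGaussianField 4 D`. Proof (lead c1's soft argument,
now with every input landed): if not, pick bad `β_k → ∞`, `μ_k`; the tangent laws exist (`stub_tangent`,
assembled in `…TangentLaws`) and are identified by rigidity (`stub_rigidity` fed with the landed
R-stubs) as `curvatureGaussianField 4 D`; (T0) at the two plaquettes then contradicts badness.
Reference: S. Chatterjee, arXiv:1602.01222 §§11–14. [arXiv160201222]
-/

noncomputable section

open MeasureTheory Filter Topology

namespace Summit.QuantumFields.YangMills.Theorems.EquipartitionPinsProbe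

namespace TangentLocalLaw

open Literature.Probability.LatticeModels Literature.MathematicalPhysics.QuantumFieldTheory
open Literature.MathematicalPhysics.QuantumLattice

/-- Plaquette observables of a translated configuration: `O_{(x;i,j)}(θ_v U) = O_{(x−v;i,j)} U`. -/
theorem plaquetteObs_configShift' {G : Type} [Group G] [MeasurableSpace G] {N d : ℕ}
    (ρ : G →* Matrix (Fin N) (Fin N) ℂ) (v x : Site d) (i j : Fin d) (U : LGConfig d G) :
    plaquetteObs ρ x i j (configShift v U) = plaquetteObs ρ (x - v) i j U := by
  simp only [plaquetteObs, plaquetteHolonomyZd,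
    Literature.MathematicalPhysics.QuantumLattice.configShift_apply, add_sub_right_comm]

/-- The probe `ψ(u) = exp(−2u₊)` at `u = s/2`, `s ≥ 0`, is `exp(−s)`. -/
theorem probe_half {s : ℝ} (hs : 0 ≤ s) : Real.exp (-2 * max ((1 / 2 : ℝ) * s) 0) = Real.exp (-s) := by
  rw [max_eq_left (by positivity)]
  congr 1
  ring

end TangentLocalLaw

open Literature.Probability.LatticeModels Literature.MathematicalPhysics.QuantumFieldTheory
open Literature.MathematicalPhysics.QuantumLattice TangentLocalLaw in
/-- STUB `stub_localLaw` of line `Sketch` (crux `stmt-QuantumFields-8760`) — **the local free-gluon law**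
(two-plaquette probe shadow), from the tangent laws (`stub_tangent`) and rigidity (`stub_rigidity`). -/
theorem stub_localLaw :
    ∀ (G : Type) [Group G] [TopologicalSpace G] [IsTopologicalGroup G] [CompactSpace G],
      Literature.MathematicalPhysics.QuantumFieldTheory.IsCompactSimpleLieGroup G →
      letI : MeasurableSpace G := borel G
      haveI : BorelSpace G := ⟨rfl⟩
      ∀ r : Literature.MathematicalPhysics.QuantumFieldTheory.LatticeRep G,
        (∀ ε : ℝ, 0 < ε → ∀ᶠ β : ℝ in Filter.atTop,
          ∀ μ ∈ Literature.MathematicalPhysics.QuantumLattice.infiniteVolumeLimitPoints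
              (d := 4) r.ρ β,
            |β * (∫ U, (∑ i : Fin 4, ∑ j : Fin 4,
                if i < j then ((r.N : ℝ) -
                  Literature.MathematicalPhysics.QuantumLattice.plaquetteObs r.ρ 0 i j U) else 0) ∂μ) -
              3 * (Module.finrank ℝ ↥(Submodule.span ℝ {X : Matrix (Fin r.N) (Fin r.N) ℂ |
                ∀ t : ℝ, NormedSpace.exp ((t : ℂ) • X) ∈ Set.range r.ρ}) : ℝ) / 2| < ε) →
        ∃ D : ℕ, 0 < D ∧
          ∀ (n : ℕ) (ε : ℝ), 0 < ε → ∀ᶠ β : ℝ in Filter.atTop,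
            ∀ μ ∈ Literature.MathematicalPhysics.QuantumLattice.infiniteVolumeLimitPoints
                (d := 4) r.ρ β,
              |(∫ U, Real.exp (-2 * max (β * ((r.N : ℝ) -
                    Literature.MathematicalPhysics.QuantumLattice.plaquetteObs r.ρ 0 1 2 U)) 0) *
                  Real.exp (-2 * max (β * ((r.N : ℝ) -
                    Literature.MathematicalPhysics.QuantumLattice.plaquetteObs r.ρ 0 1 2
                      (Literature.MathematicalPhysics.QuantumLattice.configShift
                        (-(Pi.single 0 (n : ℤ))) U))) 0) ∂μ) -
                (∫ U, Real.exp (-2 * max (β * ((r.N : ℝ) -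
                    Literature.MathematicalPhysics.QuantumLattice.plaquetteObs r.ρ 0 1 2 U)) 0) ∂μ) *
                (∫ U, Real.exp (-2 * max (β * ((r.N : ℝ) -
                    Literature.MathematicalPhysics.QuantumLattice.plaquetteObs r.ρ 0 1 2
                      (Literature.MathematicalPhysics.QuantumLattice.configShift
                        (-(Pi.single 0 (n : ℤ))) U))) 0) ∂μ) -
                ((∫ Y, Real.exp (-(∑ a : Fin D,
                      (Y (Literature.MathematicalPhysics.QuantumFieldTheory.plaquette12 (d := 4)
                        (by norm_num) 0) a) ^ 2)) *
                    Real.exp (-(∑ a : Fin D,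
                      (Y (Literature.MathematicalPhysics.QuantumFieldTheory.plaquette12 (d := 4)
                        (by norm_num) (Pi.single (0 : Fin 4) (n : ℤ) :
                          Literature.Probability.LatticeModels.Site 4)) a) ^ 2))
                    ∂(Literature.MathematicalPhysics.QuantumFieldTheory.curvatureGaussianField 4 D)) -
                  (∫ Y, Real.exp (-(∑ a : Fin D,
                      (Y (Literature.MathematicalPhysics.QuantumFieldTheory.plaquette12 (d := 4)
                        (by norm_num) 0) a) ^ 2))
                    ∂(Literature.MathematicalPhysics.QuantumFieldTheory.curvatureGaussianField 4 D)) *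
                  (∫ Y, Real.exp (-(∑ a : Fin D,
                      (Y (Literature.MathematicalPhysics.QuantumFieldTheory.plaquette12 (d := 4)
                        (by norm_num) (Pi.single (0 : Fin 4) (n : ℤ) :
                          Literature.Probability.LatticeModels.Site 4)) a) ^ 2))
                    ∂(Literature.MathematicalPhysics.QuantumFieldTheory.curvatureGaussianField 4 D)))| < ε := by
  intro G _ _ _ _ hG
  letI : MeasurableSpace G := borel G
  haveI : BorelSpace G := ⟨rfl⟩
  intro r hequi
  obtain ⟨D, hD, hTan⟩ := stub_tangent G hG r hequi
  have hR := stub_rigidity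
    (stub_factorization (stub_exactShiftInvariance stub_steinFlow stub_kernelFixesExact)
      (stub_cubeShiftInvariance stub_kernelClosed) stub_density)
    stub_cosMoment stub_lineVariance stub_gaussFromCharFun
  refine ⟨D, hD, ?_⟩
  intro n ε hε
  -- the probe and the two plaquettes
  set ψ : ℝ → ℝ := fun u => Real.exp (-2 * max u 0) with hψ
  have hψc : Continuous ψ := by
    simp only [hψ]
    fun_prop
  have hψb : ∀ u, |ψ u| ≤ 1 := fun u => by
    simp only [hψ]
    rw [abs_of_pos (Real.exp_pos _)]
    apply Real.exp_le_one_iff.2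
    have : 0 ≤ max u 0 := le_max_right _ _
    linarith
  set p0 : ZdPlaquette 4 := plaquette12 (d := 4) Reduction.three_le_four 0 with hp0
  set pn : ZdPlaquette 4 := plaquette12 (d := 4) Reduction.three_le_four (Pi.single (0 : Fin 4) (n : ℤ))
    with hpn
  by_contra hcon
  -- extract a bad sequence `βs k ≥ k`, `μs k`
  rw [Filter.not_eventually] at hcon
  have hfreq := Filter.frequently_atTop.1 hcon
  choose βs hβs hbad using fun k : ℕ => hfreq (k : ℝ)
  have hbad' : ∀ k : ℕ, ∃ μ ∈ infiniteVolumeLimitPoints (d := 4) r.ρ (βs k),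
      ε ≤ |(∫ U, ψ (βs k * ((r.N : ℝ) - plaquetteObs r.ρ 0 1 2 U)) *
              ψ (βs k * ((r.N : ℝ) - plaquetteObs r.ρ 0 1 2
                (configShift (-(Pi.single 0 (n : ℤ))) U))) ∂μ) -
            (∫ U, ψ (βs k * ((r.N : ℝ) - plaquetteObs r.ρ 0 1 2 U)) ∂μ) *
            (∫ U, ψ (βs k * ((r.N : ℝ) - plaquetteObs r.ρ 0 1 2
                (configShift (-(Pi.single 0 (n : ℤ))) U))) ∂μ) -
            ((∫ Y, Real.exp (-(∑ a : Fin D, (Y p0 a) ^ 2)) *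
                Real.exp (-(∑ a : Fin D, (Y pn a) ^ 2)) ∂(curvatureGaussianField 4 D)) -
              (∫ Y, Real.exp (-(∑ a : Fin D, (Y p0 a) ^ 2)) ∂(curvatureGaussianField 4 D)) *
              (∫ Y, Real.exp (-(∑ a : Fin D, (Y pn a) ^ 2)) ∂(curvatureGaussianField 4 D)))| := by
    intro k
    have hk := hbad k
    push Not at hk
    obtain ⟨μ, hμ, hge⟩ := hk
    exact ⟨μ, hμ, hge⟩
  choose μs hμs hge using hbad'
  have hβtend : Tendsto βs atTop atTop :=
    tendsto_atTop_mono hβs tendsto_natCast_atTop_atTop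
  obtain ⟨φ, τ, hφ, hτ, hT0, hT1, hT2, hT3⟩ := hTan βs μs hβtend hμs
  have hτeq : τ = curvatureGaussianField 4 D := hR D τ hτ hT1 hT2 hT3
  -- the three test functions
  set f2 : (Fin 2 → ℝ) → ℝ := fun v => ψ (v 0) * ψ (v 1) with hf2
  set fa : (Fin 2 → ℝ) → ℝ := fun v => ψ (v 0) with hfa
  set fb : (Fin 2 → ℝ) → ℝ := fun v => ψ (v 1) with hfb
  have hf2c : Continuous f2 := by simp only [hf2]; fun_prop
  have hfac : Continuous fa := by simp only [hfa]; fun_prop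
  have hfbc : Continuous fb := by simp only [hfb]; fun_prop
  have hf2b : ∃ C : ℝ, ∀ v, |f2 v| ≤ C := ⟨1, fun v => by
    simp only [hf2, abs_mul]
    calc |ψ (v 0)| * |ψ (v 1)| ≤ 1 * 1 :=
          mul_le_mul (hψb _) (hψb _) (abs_nonneg _) zero_le_one
      _ = 1 := one_mul _⟩
  have hfab : ∃ C : ℝ, ∀ v, |fa v| ≤ C := ⟨1, fun v => hψb _⟩
  have hfbb : ∃ C : ℝ, ∀ v, |fb v| ≤ C := ⟨1, fun v => hψb _⟩
  have l2 := hT0 2 ![p0, pn] f2 hf2c hf2b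
  have la := hT0 2 ![p0, pn] fa hfac hfab
  have lb := hT0 2 ![p0, pn] fb hfbc hfbb
  -- identify the integrands on the lattice side
  have hshift : ∀ (U : LGConfig 4 G),
      plaquetteObs r.ρ 0 1 2 (configShift (-(Pi.single 0 (n : ℤ))) U) =
        plaquetteObs r.ρ pn.1 pn.2.1.1 pn.2.1.2 U := by
    intro U
    rw [plaquetteObs_configShift']
    simp [hpn, plaquette12]
  have h0 : ∀ (U : LGConfig 4 G),
      plaquetteObs r.ρ 0 1 2 U = plaquetteObs r.ρ p0.1 p0.2.1.1 p0.2.1.2 U := by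
    intro U
    simp [hp0, plaquette12]
  -- identify the integrands on the Gaussian side
  have hG2 : ∀ Y : ZdPlaquette 4 → Fin D → ℝ,
      f2 (fun i => (1 / 2 : ℝ) * ∑ a : Fin D, (Y (![p0, pn] i) a) ^ 2) =
        Real.exp (-(∑ a : Fin D, (Y p0 a) ^ 2)) * Real.exp (-(∑ a : Fin D, (Y pn a) ^ 2)) := by
    intro Y
    simp only [hf2, hψ, Matrix.cons_val_zero, Matrix.cons_val_one]
    rw [probe_half (Finset.sum_nonneg fun a _ => sq_nonneg _),
      probe_half (Finset.sum_nonneg fun a _ => sq_nonneg _)]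
  have hGa : ∀ Y : ZdPlaquette 4 → Fin D → ℝ,
      fa (fun i => (1 / 2 : ℝ) * ∑ a : Fin D, (Y (![p0, pn] i) a) ^ 2) =
        Real.exp (-(∑ a : Fin D, (Y p0 a) ^ 2)) := by
    intro Y
    simp only [hfa, hψ, Matrix.cons_val_zero]
    rw [probe_half (Finset.sum_nonneg fun a _ => sq_nonneg _)]
  have hGb : ∀ Y : ZdPlaquette 4 → Fin D → ℝ,
      fb (fun i => (1 / 2 : ℝ) * ∑ a : Fin D, (Y (![p0, pn] i) a) ^ 2) =
        Real.exp (-(∑ a : Fin D, (Y pn a) ^ 2)) := by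
    intro Y
    simp only [hfb, hψ, Matrix.cons_val_one, Matrix.cons_val_fin_one]
    rw [probe_half (Finset.sum_nonneg fun a _ => sq_nonneg _)]
  simp only [hG2] at l2
  simp only [hGa] at la
  simp only [hGb] at lb
  -- lattice side
  have hL2 : ∀ (j : ℕ) (U : LGConfig 4 G),
      f2 (fun i => βs (φ j) * ((r.N : ℝ) - plaquetteObs r.ρ
          ((![p0, pn] : Fin 2 → ZdPlaquette 4) i).1 ((![p0, pn] : Fin 2 → ZdPlaquette 4) i).2.1.1
          ((![p0, pn] : Fin 2 → ZdPlaquette 4) i).2.1.2 U)) =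
        ψ (βs (φ j) * ((r.N : ℝ) - plaquetteObs r.ρ 0 1 2 U)) *
          ψ (βs (φ j) * ((r.N : ℝ) - plaquetteObs r.ρ 0 1 2
            (configShift (-(Pi.single 0 (n : ℤ))) U))) := by
    intro j U
    simp only [hf2, Matrix.cons_val_zero, Matrix.cons_val_one, hshift, h0]
  have hLa : ∀ (j : ℕ) (U : LGConfig 4 G),
      fa (fun i => βs (φ j) * ((r.N : ℝ) - plaquetteObs r.ρ
          ((![p0, pn] : Fin 2 → ZdPlaquette 4) i).1 ((![p0, pn] : Fin 2 → ZdPlaquette 4) i).2.1.1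
          ((![p0, pn] : Fin 2 → ZdPlaquette 4) i).2.1.2 U)) =
        ψ (βs (φ j) * ((r.N : ℝ) - plaquetteObs r.ρ 0 1 2 U)) := by
    intro j U
    simp only [hfa, Matrix.cons_val_zero, h0]
  have hLb : ∀ (j : ℕ) (U : LGConfig 4 G),
      fb (fun i => βs (φ j) * ((r.N : ℝ) - plaquetteObs r.ρ
          ((![p0, pn] : Fin 2 → ZdPlaquette 4) i).1 ((![p0, pn] : Fin 2 → ZdPlaquette 4) i).2.1.1
          ((![p0, pn] : Fin 2 → ZdPlaquette 4) i).2.1.2 U)) =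
        ψ (βs (φ j) * ((r.N : ℝ) - plaquetteObs r.ρ 0 1 2
            (configShift (-(Pi.single 0 (n : ℤ))) U))) := by
    intro j U
    simp only [hfb, Matrix.cons_val_one, Matrix.cons_val_fin_one, hshift]
  simp only [hL2] at l2
  simp only [hLa] at la
  simp only [hLb] at lb
  -- combine
  have lcov := l2.sub (la.mul lb)
  rw [hτeq] at lcov
  have hev := (Metric.tendsto_nhds.1 lcov) ε hε
  obtain ⟨j, hj⟩ := hev.exists
  have := hge (φ j)
  rw [Real.dist_eq] at hj
  linarith

end Summit.QuantumFields.YangMills.Theorems.EquipartitionPinsProbe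

end
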